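import Summits.NavierStokesRegularity.FluidComputer.PalasekTowerLiveClassAtHelicity
import Literature.Analysis.FluidPDE.BurgersVortexSteady

/-!
# THE HELICITY CERTIFICATE OF THE LIVE CLASS IS INHABITED: the Burgers vortex (strained tube WITH swirl) has helicity
# density `γ²Γ/(4πν) ≠ 0` on its axis, hence is dead (axisymmetric AND swirl-free) in NO rigid placement

Cell `ns-blowup`, seat `ns-blowup-refuter4` (g10, K211; ledger refuter of record for route `PalasekTowerBreakdown` rev 19, cruxes
stmt-NavierStokesRegularity-20304 `HeredityAtOneT` / -20305 `HeredityFromTwoT`; live-class hedge `LiveHeredityAtGAt` /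
`LiveStageAt` of fc-prover-2 (p530059/p530830) and its HELICITY RIDER p533364 `Literature/…/HelicityDensityPseudoscalar` +
p535221 `FluidComputer/PalasekTowerLiveClassAtHelicity` — `not_deadSlice_of_inner_self_curl_ne_zero : ContDiff ℝ 1 v →
⟪v x, curl v x⟫ ≠ 0 → ¬ DeadSlice v`, `deadSlice_conjSlice_iff`). Negative-lane SUPPORT (`--supports 20304`), no Theses import.

fc-prover-2's rider is a one-point SUFFICIENT test for liveness; its files carry no inhabitant. This file supplies the canonical
one by kernel: for `γ, ν, Γ ≠ 0` the Burgers vortex `burgersVortex γ ν Γ = axisymmetricStrain γ + burgersVortexSwirl γ ν Γ`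
(`Literature/…/BurgersVortexSteady`, an exact steady Navier–Stokes solution at viscosity `ν`) has, at the axis point `(0,0,1)`,
velocity with axial component `γ` (the strain; the swirl vanishes on the axis) and vorticity `ω(0)·e_z`, `ω(0) = γΓ/(4πν)`
(`curl_burgersVortex`), so `⟪u, curl u⟫(0,0,1) = γ·γΓ/(4πν) ≠ 0`:

* `burgersVortex_inner_self_curl_axis` — the helicity density on the axis at height `1`, in closed form;
* `not_deadSlice_burgersVortex` — `¬ DeadSlice (burgersVortex γ ν Γ)`;
* `not_deadSlice_conjSlice_burgersVortex` — the same for every rigid placement `conjSlice A b (burgersVortex γ ν Γ)`.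

So the live class `LiveStageAt` is not vacuous for the reason "no smooth field passes the helicity test": the textbook strained
vortex passes it. (The test is not NECESSARY: a columnar swirling vortex `q(r)·rotGen` has `⟪v, curl v⟫ ≡ 0` — horizontal velocity,
vertical vorticity — and is live; not typed here.)

WHAT THIS IS NOT: not NS dynamics — a pointwise evaluation of an explicit steady field and its curl; nothing about any stage,
register, run or blow-up; 20304/20305 stay OPEN.
-/

noncomputable section

namespace Summit.NavierStokesRegularity.HeredityAtOneTBurgersLive

open Real
open scoped RealInnerProductSpace
open Literature.Analysis.FluidPDE
open Summit.NavierStokesRegularity.FluidComputer.PalasekTowerClayBridge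

/-- **Helicity density of the Burgers vortex on its axis at height `1`**: `⟪u, curl u⟫(0,0,1) = γ · γΓ/(4πν)` (the strain's
axial velocity `γ x₂` times the Gaussian core vorticity `ω(0) e_z`; the swirl vanishes on the axis).
[cite: Frisch1995, §8.9.1 eq. (8.140)] -/
theorem burgersVortex_inner_self_curl_axis (γ ν Γ : ℝ) :
    ⟪burgersVortex γ ν Γ (EuclideanSpace.single 2 1), curl (burgersVortex γ ν Γ) (EuclideanSpace.single 2 1)⟫ =
      γ * (γ * Γ / (4 * π * ν)) := by
  rw [curl_burgersVortex, real_inner_smul_right, EuclideanSpace.inner_single_right]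
  simp [burgersVortex, axisymmetricStrain, burgersVortexSwirl, burgersVorticity, rotGen]
  ring

/-- … which is nonzero for `γ, ν, Γ ≠ 0`. [cite: Frisch1995, §8.9.1 eq. (8.140)] -/
theorem burgersVortex_inner_self_curl_axis_ne_zero {γ ν Γ : ℝ} (hγ : γ ≠ 0) (hν : ν ≠ 0) (hΓ : Γ ≠ 0) :
    ⟪burgersVortex γ ν Γ (EuclideanSpace.single 2 1), curl (burgersVortex γ ν Γ) (EuclideanSpace.single 2 1)⟫ ≠ 0 := by
  rw [burgersVortex_inner_self_curl_axis]
  have hden : (4 * π * ν : ℝ) ≠ 0 := mul_ne_zero (mul_ne_zero four_ne_zero Real.pi_ne_zero) hν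
  exact mul_ne_zero hγ (div_ne_zero (mul_ne_zero hγ hΓ) hden)

/-- **THE BURGERS VORTEX IS LIVE**: for `γ, ν, Γ ≠ 0` the strained swirling tube `burgersVortex γ ν Γ` is axisymmetric AND
swirl-free in NO rigid placement (`¬ DeadSlice`), by fc-prover-2's helicity rider at the single point `(0, 0, 1)`.
[cite: Frisch1995, §8.9.1 eq. (8.140)] [cite: Moffatt1969, §1] -/
theorem not_deadSlice_burgersVortex {γ ν Γ : ℝ} (hγ : γ ≠ 0) (hν : ν ≠ 0) (hΓ : Γ ≠ 0) :
    ¬ DeadSlice (burgersVortex γ ν Γ) :=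
  not_deadSlice_of_inner_self_curl_ne_zero (contDiff_burgersVortex γ ν Γ) (x := EuclideanSpace.single 2 1)
    (burgersVortex_inner_self_curl_axis_ne_zero hγ hν hΓ)

/-- … and so is every rigid placement of it (frame independence of deadness, `deadSlice_conjSlice_iff`).
[cite: Frisch1995, §8.9.1 eq. (8.140)] [cite: Moffatt1969, §1] -/
theorem not_deadSlice_conjSlice_burgersVortex {γ ν Γ : ℝ} (hγ : γ ≠ 0) (hν : ν ≠ 0) (hΓ : Γ ≠ 0)
    (A : EuclideanSpace ℝ (Fin 3) ≃ₗᵢ[ℝ] EuclideanSpace ℝ (Fin 3)) (b : EuclideanSpace ℝ (Fin 3)) :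
    ¬ DeadSlice (conjSlice A b (burgersVortex γ ν Γ)) := by
  rw [deadSlice_conjSlice_iff]
  exact not_deadSlice_burgersVortex hγ hν hΓ

end Summit.NavierStokesRegularity.HeredityAtOneTBurgersLive

end
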